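import Mathlib.Data.Fintype.Card
import Mathlib.Data.Finset.Card
import Mathlib.Data.Finset.Powerset
import Mathlib.Algebra.BigOperators.Group.Finset.Basic
import Mathlib.Algebra.Group.Nat.Even
import Mathlib.Combinatorics.Enumerative.DoubleCounting
import Mathlib.Tactic
import HarnessLib

/-!
# Venture HSemireg — there is no flat (3, 7) triangle-free three-coordinate system

Cell `pub-hsemireg`, widening group W5, seat w5-n7-1 (gen 13); note of record
`widen/W5/NO-FLAT-3-7-w5n7g13.md` (hand proof + explicit enumeration), sharpening the cell
`widen/W5/TABLE-W5-N7.md` row N7-15 ∕ `N7-FEASIBILITY-w5n7.md` §3.9 (d) «flat-3, u = 7: NO triangle-free flat-3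
design exists» (exact SAT on FOUR coordinates) to THREE coordinates, with a proof.

SETTING (the lineage's abstract encoding, as in `FlatPentagonTwinFree`): three coordinates with level types
`α, β, γ` of 7 elements each; the three torus graphs are given by neighbourhood maps with transposes
(`nAB/nBA`, `nAC/nCA`, `nBC/nCB`), every level has exactly 3 neighbours in each other coordinate (a flat (3, 7)
system), and a TRIANGLE is a triple `a, b, c` with `b ∈ nAB a`, `c ∈ nBC b`, `c ∈ nAC a`.

THEOREM `exists_triangle`: such a system always has a triangle. Equivalently there is no flat (3, 7) triangle-free
three-coordinate system — a fortiori none on four or more coordinates.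

PROOF (five steps, all finite counting):
* `two_le_inter_card` — if `a, a'` have a common `C`-neighbour `c` then `nAB a, nAB a' ⊆ (nCB c)ᶜ`, a set of
  7 − 3 = 4 levels, so the two 3-sets meet in ≥ 2 levels. (Used in both orientations: a common `B`-neighbour forces
  a common `C`-neighbour and conversely — «mates».)
* `sum_inter_card` — `∑_{a' ≠ a} #(nAB a ∩ nAB a') = ∑_{b ∈ nAB a} (#(nBA b) − 1) = 3 · 2 = 6` (double count).
* `false_of_twin_free` — if no two levels of `A` have the same `B`-triple, every codegree `#(nAB a ∩ nAB a')`
  (`a ≠ a'`) is 0 or 2 (it is ≥ 2 for mates and = 3 would mean twins); double counting the pairs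
  `(b, {a, a'} ⊆ nBA b)` gives `7 · C(3,2) = 21 = ∑_{pairs} codegree`, an even number: contradiction (PARITY).
* `twin_triple` — if `a₁ ≠ a₂` are twins (`nAB a₁ = nAB a₂`) then by `sum_inter_card` there is exactly one more
  twin `a₃`, and the three are twins in `C` as well (`nAC` constant on `T = {a₁, a₂, a₃}`).
* `false_of_twins` — then every `B`-level outside `β = nAB a₁` and every `C`-level outside `γ₀ = nAC a₁` have
  their three `A`-neighbours among the 4 levels of `Tᶜ`, hence a common one, hence are NOT adjacent; so the four
  `B`-levels outside `β` all have `C`-neighbourhood `γ₀`, giving a level of `γ₀` at least 4 > 3 `B`-neighbours.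

HONEST FRAMING: finite combinatorics on 7 + 7 + 7 levels (necessary first-order conditions of the n = 7 rung).
Nothing in this file is a statement about a variety, a sheaf or a Hodge class, and nothing here bears on
HC / HC_CM / HC_AV.
-/

namespace Summit.Ventures.HSemireg.NoFlatThreeSeven

open Finset

variable {α β γ : Type*} [Fintype α] [Fintype β] [Fintype γ] [DecidableEq α] [DecidableEq β] [DecidableEq γ]

omit [Fintype α] [Fintype γ] [DecidableEq α] [DecidableEq γ] in
/-- **Shadows.** If two levels `a, a'` of `A` have a common `C`-neighbour `c`, their `B`-neighbourhoods both avoid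
`nCB c` (a common level would close a triangle), i.e. they are 3-subsets of a 4-set, so they meet in at least
2 levels. -/
theorem two_le_inter_card (hβ : Fintype.card β = 7) (nAB : α → Finset β) (nAC : α → Finset γ)
    (nBC : β → Finset γ) (nCB : γ → Finset β) (cBC : ∀ b c, c ∈ nBC b ↔ b ∈ nCB c)
    (rAB : ∀ a, (nAB a).card = 3) (rCB : ∀ c, (nCB c).card = 3)
    (tABC : ∀ a b c, b ∈ nAB a → c ∈ nBC b → c ∉ nAC a) {a a' : α} {c : γ} (hc : c ∈ nAC a)
    (hc' : c ∈ nAC a') : 2 ≤ (nAB a ∩ nAB a').card := by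
  have hsub : nAB a ∪ nAB a' ⊆ (nCB c)ᶜ := by
    intro b hb
    rw [mem_compl]
    intro hbc
    rw [mem_union] at hb
    rcases hb with hb | hb
    · exact tABC a b c hb ((cBC b c).2 hbc) hc
    · exact tABC a' b c hb ((cBC b c).2 hbc) hc'
  have h1 := card_le_card hsub
  rw [card_compl, rCB, hβ] at h1
  have h2 := card_union_add_card_inter (nAB a) (nAB a')
  rw [rAB, rAB] at h2
  omega

omit [Fintype β] in
/-- **Codegree sum.** For a fixed level `a` of `A`: `∑_{a' ≠ a} #(nAB a ∩ nAB a') = 6` — double count the pairs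
`(a', b)` with `a' ≠ a` and `b` a common `B`-neighbour of `a` and `a'`: each of the 3 levels `b ∈ nAB a` has
exactly 2 further `A`-neighbours. -/
theorem sum_inter_card (nAB : α → Finset β) (nBA : β → Finset α) (cAB : ∀ a b, b ∈ nAB a ↔ a ∈ nBA b)
    (rAB : ∀ a, (nAB a).card = 3) (rBA : ∀ b, (nBA b).card = 3) (a : α) :
    ∑ a' ∈ univ.erase a, (nAB a ∩ nAB a').card = 6 := by
  have hdc := Finset.sum_card_bipartiteAbove_eq_sum_card_bipartiteBelow (s := univ.erase a) (t := nAB a)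
    (r := fun a' b => b ∈ nAB a')
  have hL : ∀ a' ∈ univ.erase a,
      ((nAB a).bipartiteAbove (fun a' b => b ∈ nAB a') a').card = (nAB a ∩ nAB a').card := by
    intro a' _
    congr 1
  have hR : ∀ b ∈ nAB a, ((univ.erase a).bipartiteBelow (fun a' b => b ∈ nAB a') b).card = 2 := by
    intro b hb
    have : (univ.erase a).bipartiteBelow (fun a' b => b ∈ nAB a') b = (nBA b).erase a := by
      ext a'
      simp only [bipartiteBelow, mem_filter, mem_erase, mem_univ, and_true, cAB]
    rw [this, card_erase_of_mem ((cAB a b).1 hb), rBA]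
  rw [sum_congr rfl hL, sum_congr rfl hR, sum_const, rAB, smul_eq_mul] at hdc
  exact hdc

omit [Fintype α] [Fintype β] [DecidableEq α] in
/-- Two 3-sets meeting in 3 levels are equal. -/
theorem eq_of_inter_card_eq_three (nAB : α → Finset β) (rAB : ∀ a, (nAB a).card = 3) {a a' : α}
    (h : (nAB a ∩ nAB a').card = 3) : nAB a' = nAB a := by
  have h1 : nAB a ∩ nAB a' = nAB a := eq_of_subset_of_card_le inter_subset_left (by rw [h, rAB])
  have h2 : nAB a ∩ nAB a' = nAB a' := eq_of_subset_of_card_le inter_subset_right (by rw [h, rAB])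
  rw [← h2, h1]

/-- **The twin-free branch (parity).** If no two levels of `A` have the same `B`-neighbourhood, the system has a
triangle. For: a pair `a ≠ a'` with a common `B`-neighbour has a common `C`-neighbour (`two_le_inter_card` with
`B` and `C` exchanged), hence meets in ≥ 2 `B`-levels, and not in 3 (twins); so every codegree is 0 or 2. Double
counting the pairs `(b, s)` with `s` a 2-subset of `nBA b` gives `7 · 3 = 21` on one side and the (even) sum of
the codegrees on the other. -/
theorem false_of_twin_free (hβ : Fintype.card β = 7) (hγ : Fintype.card γ = 7)
    (nAB : α → Finset β) (nBA : β → Finset α) (nAC : α → Finset γ) (nBC : β → Finset γ) (nCB : γ → Finset β)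
    (cAB : ∀ a b, b ∈ nAB a ↔ a ∈ nBA b) (cBC : ∀ b c, c ∈ nBC b ↔ b ∈ nCB c)
    (rAB : ∀ a, (nAB a).card = 3) (rBA : ∀ b, (nBA b).card = 3) (rAC : ∀ a, (nAC a).card = 3)
    (rBC : ∀ b, (nBC b).card = 3) (rCB : ∀ c, (nCB c).card = 3)
    (tABC : ∀ a b c, b ∈ nAB a → c ∈ nBC b → c ∉ nAC a)
    (htf : ∀ a₁ a₂, a₁ ≠ a₂ → nAB a₁ ≠ nAB a₂) : False := by
  -- every codegree is 0 or 2
  have h02 : ∀ a₁ a₂, a₁ ≠ a₂ → (nAB a₁ ∩ nAB a₂).card = 0 ∨ (nAB a₁ ∩ nAB a₂).card = 2 := by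
    intro a₁ a₂ hne
    by_cases h0 : (nAB a₁ ∩ nAB a₂).card = 0
    · exact Or.inl h0
    right
    obtain ⟨b, hb⟩ := card_pos.1 (Nat.pos_of_ne_zero h0)
    rw [mem_inter] at hb
    -- a common B-neighbour forces a common C-neighbour (the lemma with B and C exchanged) …
    have hC : 2 ≤ (nAC a₁ ∩ nAC a₂).card :=
      two_le_inter_card hγ nAC nAB nCB nBC (fun c b => (cBC b c).symm) rAC rBC
        (fun a c b hc hcb hb => tABC a b c hb ((cBC b c).2 hcb) hc) hb.1 hb.2
    obtain ⟨c, hc⟩ := card_pos.1 (by omega : 0 < (nAC a₁ ∩ nAC a₂).card)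
    rw [mem_inter] at hc
    -- … which forces codegree ≥ 2 in B; and codegree 3 would mean twins
    have h2 := two_le_inter_card hβ nAB nAC nBC nCB cBC rAB rCB tABC hc.1 hc.2
    have h3 : (nAB a₁ ∩ nAB a₂).card ≤ 3 := (card_le_card inter_subset_left).trans (rAB a₁).le
    have hne3 : (nAB a₁ ∩ nAB a₂).card ≠ 3 := fun h =>
      htf a₁ a₂ hne (eq_of_inter_card_eq_three nAB rAB h).symm
    omega
  -- double count the pairs (b, s), s a 2-subset of A inside nBA b
  have hdc := Finset.sum_card_bipartiteAbove_eq_sum_card_bipartiteBelow (s := (univ : Finset β))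
    (t := (univ : Finset α).powersetCard 2) (r := fun b s => s ⊆ nBA b)
  have hL : ∀ b ∈ (univ : Finset β),
      (((univ : Finset α).powersetCard 2).bipartiteAbove (fun b s => s ⊆ nBA b) b).card = 3 := by
    intro b _
    have : ((univ : Finset α).powersetCard 2).bipartiteAbove (fun b s => s ⊆ nBA b) b
        = (nBA b).powersetCard 2 := by
      ext s
      simp only [bipartiteAbove, mem_filter, mem_powersetCard, subset_univ, true_and]
      exact ⟨fun h => ⟨h.2, h.1⟩, fun h => ⟨h.2, h.1⟩⟩
    rw [this, card_powersetCard, rBA]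
    rfl
  have hR : ∀ s ∈ (univ : Finset α).powersetCard 2,
      Even (((univ : Finset β).bipartiteBelow (fun b s => s ⊆ nBA b) s).card) := by
    intro s hs
    rw [mem_powersetCard] at hs
    obtain ⟨a₁, a₂, hne, rfl⟩ := card_eq_two.1 hs.2
    have : (univ : Finset β).bipartiteBelow (fun b s => s ⊆ nBA b) {a₁, a₂} = nAB a₁ ∩ nAB a₂ := by
      ext b
      simp only [bipartiteBelow, mem_filter, mem_univ, true_and, insert_subset_iff, singleton_subset_iff,
        mem_inter, cAB]
    rw [this]
    rcases h02 a₁ a₂ hne with h | h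
    · rw [h]; exact ⟨0, rfl⟩
    · rw [h]; exact even_two
  have h21 : ∑ b ∈ (univ : Finset β),
      (((univ : Finset α).powersetCard 2).bipartiteAbove (fun b s => s ⊆ nBA b) b).card = 21 := by
    rw [sum_congr rfl hL, sum_const, card_univ, hβ, smul_eq_mul]
  have hev := Finset.even_sum _ hR
  rw [← hdc, h21] at hev
  exact absurd hev (by decide)

/-- **Twin triple.** If `a₁ ≠ a₂` are twins for `nAB`, there is a third twin `a₃`, and the three levels are twins
for `nAC` as well. (In `sum_inter_card`'s sum for `a₁` the level `a₂` contributes 3 and every other mate between 2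
and 3; the remaining 3 is odd, so it is ONE further term equal to 3 — a third twin `a₃` — and nothing else; then the
`C`-codegree sum 6 is carried by `a₂, a₃` alone, so both `C`-codegrees are 3.) -/
theorem twin_triple (hβ : Fintype.card β = 7) (hγ : Fintype.card γ = 7)
    (nAB : α → Finset β) (nBA : β → Finset α) (nAC : α → Finset γ) (nCA : γ → Finset α)
    (nBC : β → Finset γ) (nCB : γ → Finset β)
    (cAB : ∀ a b, b ∈ nAB a ↔ a ∈ nBA b) (cAC : ∀ a c, c ∈ nAC a ↔ a ∈ nCA c)
    (cBC : ∀ b c, c ∈ nBC b ↔ b ∈ nCB c)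
    (rAB : ∀ a, (nAB a).card = 3) (rBA : ∀ b, (nBA b).card = 3) (rAC : ∀ a, (nAC a).card = 3)
    (rCA : ∀ c, (nCA c).card = 3) (rBC : ∀ b, (nBC b).card = 3) (rCB : ∀ c, (nCB c).card = 3)
    (tABC : ∀ a b c, b ∈ nAB a → c ∈ nBC b → c ∉ nAC a)
    {a₁ a₂ : α} (hne : a₁ ≠ a₂) (htw : nAB a₁ = nAB a₂) :
    ∃ a₃, a₃ ≠ a₁ ∧ a₃ ≠ a₂ ∧ nAB a₃ = nAB a₁ ∧ nAC a₂ = nAC a₁ ∧ nAC a₃ = nAC a₁ := by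
  -- codegrees with a₁ are 0 or in [2, 3], in B and in C
  have hB : ∀ a', (nAB a₁ ∩ nAB a').card = 0 ∨ 2 ≤ (nAB a₁ ∩ nAB a').card := by
    intro a'
    by_cases h0 : (nAB a₁ ∩ nAB a').card = 0
    · exact Or.inl h0
    right
    obtain ⟨b, hb⟩ := card_pos.1 (Nat.pos_of_ne_zero h0)
    rw [mem_inter] at hb
    have hC : 2 ≤ (nAC a₁ ∩ nAC a').card :=
      two_le_inter_card hγ nAC nAB nCB nBC (fun c b => (cBC b c).symm) rAC rBC
        (fun a c b hc hcb hb => tABC a b c hb ((cBC b c).2 hcb) hc) hb.1 hb.2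
    obtain ⟨c, hc⟩ := card_pos.1 (by omega : 0 < (nAC a₁ ∩ nAC a').card)
    rw [mem_inter] at hc
    exact two_le_inter_card hβ nAB nAC nBC nCB cBC rAB rCB tABC hc.1 hc.2
  have hB3 : ∀ a', (nAB a₁ ∩ nAB a').card ≤ 3 := fun a' =>
    (card_le_card inter_subset_left).trans (rAB a₁).le
  have hC3 : ∀ a', (nAC a₁ ∩ nAC a').card ≤ 3 := fun a' =>
    (card_le_card inter_subset_left).trans (rAC a₁).le
  -- a C-mate is a B-mate
  have hCB : ∀ a', (nAB a₁ ∩ nAB a').card = 0 → (nAC a₁ ∩ nAC a').card = 0 := by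
    intro a' h0
    by_contra h
    obtain ⟨c, hc⟩ := card_pos.1 (Nat.pos_of_ne_zero h)
    rw [mem_inter] at hc
    have := two_le_inter_card hβ nAB nAC nBC nCB cBC rAB rCB tABC hc.1 hc.2
    omega
  -- the B-sum: 6 = 3 (from a₂) + the rest
  have hsum := sum_inter_card nAB nBA cAB rAB rBA a₁
  have ha₂ : a₂ ∈ univ.erase a₁ := mem_erase.2 ⟨hne.symm, mem_univ _⟩
  rw [← sum_erase_add _ _ ha₂, ← htw, inter_self, rAB] at hsum
  -- hsum : ∑ over R := (univ.erase a₁).erase a₂ = 3 (after arithmetic)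
  set R := (univ.erase a₁).erase a₂ with hR
  have hR3 : ∑ a' ∈ R, (nAB a₁ ∩ nAB a').card = 3 := by omega
  -- some term of R equals 3 (else all terms are 0 or 2 and the sum is even)
  obtain ⟨a₃, ha₃R, ha₃⟩ : ∃ a₃ ∈ R, (nAB a₁ ∩ nAB a₃).card = 3 := by
    by_contra hno
    push Not at hno
    have hev : Even (∑ a' ∈ R, (nAB a₁ ∩ nAB a').card) := by
      refine Finset.even_sum _ fun a' ha' => ?_
      rcases hB a' with h | h
      · rw [h]; exact ⟨0, rfl⟩
      · have := hB3 a'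
        have := hno a' ha'
        have h2 : (nAB a₁ ∩ nAB a').card = 2 := by omega
        rw [h2]; exact even_two
    rw [hR3] at hev
    exact absurd hev (by decide)
  have ha₃₁ : a₃ ≠ a₁ := (mem_erase.1 (mem_erase.1 ha₃R).2).1
  have ha₃₂ : a₃ ≠ a₂ := (mem_erase.1 ha₃R).1
  -- all other terms of R vanish
  have hrest : ∀ a' ∈ R.erase a₃, (nAB a₁ ∩ nAB a').card = 0 := by
    have h0 : ∑ a' ∈ R.erase a₃, (nAB a₁ ∩ nAB a').card = 0 := by
      have := sum_erase_add R (fun a' => (nAB a₁ ∩ nAB a').card) ha₃R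
      omega
    exact sum_eq_zero_iff.1 h0
  -- the C-sum: 6 = (term a₂) + (term a₃) + 0
  have hsumC := sum_inter_card nAC nCA cAC rAC rCA a₁
  rw [← sum_erase_add _ _ ha₂, ← sum_erase_add _ _ ha₃R] at hsumC
  have hzero : ∑ a' ∈ R.erase a₃, (nAC a₁ ∩ nAC a').card = 0 :=
    sum_eq_zero_iff.2 fun a' ha' => hCB a' (hrest a' ha')
  rw [hzero, zero_add] at hsumC
  have h2 := hC3 a₂
  have h3 := hC3 a₃
  refine ⟨a₃, ha₃₁, ha₃₂, eq_of_inter_card_eq_three nAB rAB ha₃, ?_, ?_⟩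
  · exact eq_of_inter_card_eq_three nAC rAC (by omega)
  · exact eq_of_inter_card_eq_three nAC rAC (by omega)

/-- **The twin branch.** Twins `a₁ ≠ a₂` for `nAB` are impossible: with the twin triple `T` of `twin_triple`
(`nAB = β`, `nAC = γ₀` on `T`), a `B`-level outside `β` and a `C`-level outside `γ₀` both have their three
`A`-neighbours among the four levels of `Tᶜ`, hence share one, hence are not adjacent; so every `B`-level outside
`β` has `C`-neighbourhood exactly `γ₀`, and a level of `γ₀` gets ≥ 4 > 3 `B`-neighbours. -/
theorem false_of_twins (hα : Fintype.card α = 7) (hβ : Fintype.card β = 7) (hγ : Fintype.card γ = 7)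
    (nAB : α → Finset β) (nBA : β → Finset α) (nAC : α → Finset γ) (nCA : γ → Finset α)
    (nBC : β → Finset γ) (nCB : γ → Finset β)
    (cAB : ∀ a b, b ∈ nAB a ↔ a ∈ nBA b) (cAC : ∀ a c, c ∈ nAC a ↔ a ∈ nCA c)
    (cBC : ∀ b c, c ∈ nBC b ↔ b ∈ nCB c)
    (rAB : ∀ a, (nAB a).card = 3) (rBA : ∀ b, (nBA b).card = 3) (rAC : ∀ a, (nAC a).card = 3)
    (rCA : ∀ c, (nCA c).card = 3) (rBC : ∀ b, (nBC b).card = 3) (rCB : ∀ c, (nCB c).card = 3)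
    (tABC : ∀ a b c, b ∈ nAB a → c ∈ nBC b → c ∉ nAC a)
    {a₁ a₂ : α} (hne : a₁ ≠ a₂) (htw : nAB a₁ = nAB a₂) : False := by
  obtain ⟨a₃, h31, h32, hB3, hC2, hC3⟩ :=
    twin_triple hβ hγ nAB nBA nAC nCA nBC nCB cAB cAC cBC rAB rBA rAC rCA rBC rCB tABC hne htw
  set T : Finset α := {a₁, a₂, a₃} with hT
  have hTcard : T.card = 3 := card_eq_three.2 ⟨a₁, a₂, a₃, hne, h31.symm, h32.symm, rfl⟩
  have hTc : (Tᶜ).card = 4 := by rw [card_compl, hTcard, hα]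
  -- on T the neighbourhood maps are constant
  have hTB : ∀ a ∈ T, nAB a = nAB a₁ := by
    intro a ha
    rw [hT, mem_insert, mem_insert, mem_singleton] at ha
    rcases ha with rfl | rfl | rfl
    · rfl
    · exact htw.symm
    · exact hB3
  have hTC : ∀ a ∈ T, nAC a = nAC a₁ := by
    intro a ha
    rw [hT, mem_insert, mem_insert, mem_singleton] at ha
    rcases ha with rfl | rfl | rfl
    · rfl
    · exact hC2
    · exact hC3
  -- levels outside β resp. γ₀ have their A-neighbours in Tᶜ
  have hBout : ∀ b, b ∉ nAB a₁ → nBA b ⊆ Tᶜ := by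
    intro b hb a ha
    rw [mem_compl]
    intro haT
    exact hb (hTB a haT ▸ (cAB a b).2 ha)
  have hCout : ∀ c, c ∉ nAC a₁ → nCA c ⊆ Tᶜ := by
    intro c hc a ha
    rw [mem_compl]
    intro haT
    exact hc (hTC a haT ▸ (cAC a c).2 ha)
  -- such b and c are never adjacent (their A-triples inside the 4-set Tᶜ meet; a common level is a triangle)
  have hnadj : ∀ b, b ∉ nAB a₁ → ∀ c, c ∉ nAC a₁ → c ∉ nBC b := by
    intro b hb c hc hbc
    have hdisj : Disjoint (nBA b) (nCA c) := by
      rw [Finset.disjoint_left]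
      intro a hab hac
      exact tABC a b c ((cAB a b).2 hab) hbc ((cAC a c).2 hac)
    have := card_le_card (union_subset (hBout b hb) (hCout c hc))
    rw [card_union_of_disjoint hdisj, rBA, rCA, hTc] at this
    omega
  -- hence every B-level outside β has C-neighbourhood exactly γ₀ = nAC a₁
  have hBγ : ∀ b, b ∉ nAB a₁ → nBC b = nAC a₁ := by
    intro b hb
    apply eq_of_subset_of_card_le
    · intro c hc
      by_contra hcγ
      exact hnadj b hb c hcγ hc
    · rw [rBC, rAC]
  -- pick a level c of γ₀: all four B-levels outside β are B-neighbours of c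
  obtain ⟨c, hc⟩ : (nAC a₁).Nonempty := card_pos.1 (by rw [rAC]; omega)
  have hsub : (nAB a₁)ᶜ ⊆ nCB c := by
    intro b hb
    rw [mem_compl] at hb
    exact (cBC b c).1 (hBγ b hb ▸ hc)
  have := card_le_card hsub
  rw [card_compl, rAB, hβ, rCB] at this
  omega

/-- **THEOREM (no flat (3, 7) triangle-free three-coordinate system).** Three 7-sets of levels with 3-regular
bipartite torus graphs between every two of them always contain a triangle: levels `a, b, c` with `b ∈ nAB a`,
`c ∈ nBC b`, `c ∈ nAC a`. (Twin-free ⇒ `false_of_twin_free` (parity 21 = 2·P); twins ⇒ `false_of_twins`.) In the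
cell's language: no flat (3, 7) cell — three, four or more coordinates — passes the triangle filter. -/
theorem exists_triangle (hα : Fintype.card α = 7) (hβ : Fintype.card β = 7) (hγ : Fintype.card γ = 7)
    (nAB : α → Finset β) (nBA : β → Finset α) (nAC : α → Finset γ) (nCA : γ → Finset α)
    (nBC : β → Finset γ) (nCB : γ → Finset β)
    (cAB : ∀ a b, b ∈ nAB a ↔ a ∈ nBA b) (cAC : ∀ a c, c ∈ nAC a ↔ a ∈ nCA c)
    (cBC : ∀ b c, c ∈ nBC b ↔ b ∈ nCB c)
    (rAB : ∀ a, (nAB a).card = 3) (rBA : ∀ b, (nBA b).card = 3) (rAC : ∀ a, (nAC a).card = 3)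
    (rCA : ∀ c, (nCA c).card = 3) (rBC : ∀ b, (nBC b).card = 3) (rCB : ∀ c, (nCB c).card = 3) :
    ∃ a b c, b ∈ nAB a ∧ c ∈ nBC b ∧ c ∈ nAC a := by
  by_contra h
  push Not at h
  by_cases htf : ∀ a₁ a₂, a₁ ≠ a₂ → nAB a₁ ≠ nAB a₂
  · exact false_of_twin_free hβ hγ nAB nBA nAC nBC nCB cAB cBC rAB rBA rAC rBC rCB h htf
  · push Not at htf
    obtain ⟨a₁, a₂, hne, htw⟩ := htf
    exact false_of_twins hα hβ hγ nAB nBA nAC nCA nBC nCB cAB cAC cBC rAB rBA rAC rCA rBC rCB h hne htw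

/-- The same theorem in the lineage's hypothesis form: a flat (3, 7) three-coordinate system with the
triangle-freeness hypothesis `tABC` is contradictory. -/
theorem no_flat_three_seven (hα : Fintype.card α = 7) (hβ : Fintype.card β = 7) (hγ : Fintype.card γ = 7)
    (nAB : α → Finset β) (nBA : β → Finset α) (nAC : α → Finset γ) (nCA : γ → Finset α)
    (nBC : β → Finset γ) (nCB : γ → Finset β)
    (cAB : ∀ a b, b ∈ nAB a ↔ a ∈ nBA b) (cAC : ∀ a c, c ∈ nAC a ↔ a ∈ nCA c)
    (cBC : ∀ b c, c ∈ nBC b ↔ b ∈ nCB c)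
    (rAB : ∀ a, (nAB a).card = 3) (rBA : ∀ b, (nBA b).card = 3) (rAC : ∀ a, (nAC a).card = 3)
    (rCA : ∀ c, (nCA c).card = 3) (rBC : ∀ b, (nBC b).card = 3) (rCB : ∀ c, (nCB c).card = 3)
    (tABC : ∀ a b c, b ∈ nAB a → c ∈ nBC b → c ∉ nAC a) : False := by
  obtain ⟨a, b, c, hab, hbc, hac⟩ :=
    exists_triangle hα hβ hγ nAB nBA nAC nCA nBC nCB cAB cAC cBC rAB rBA rAC rCA rBC rCB
  exact tABC a b c hab hbc hac

end Summit.Ventures.HSemireg.NoFlatThreeSeven
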